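import Literature.MathematicalPhysics.KineticTheory.CollisionFluxMeanBound
import Literature.MathematicalPhysics.KineticTheory.HardSphereCanonicalPairBound
import Literature.Analysis.FluidPDE.HardSphereBusyParticles
import Literature.Analysis.FluidPDE.HardSphereCollisionRecord
import HarnessLib

/-!
# The mean number of collisions and of busy particles of a window under the homogeneous Gibbs law

Topic `Literature/MathematicalPhysics/KineticTheory`; consequences of the mean collision-flux bound
`localGibbsLaw_lintegral_le_of_le_collisionMarkSum` (`CollisionFluxMeanBound`;
Cercignani–Illner–Pulvirenti 1994 App. 4.A) for the constant mark `b ≡ 1`, with all constants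
explicit and valid for EVERY reduced density `0 < σ ≤ 1/2` (no small-density hypothesis):

* `IsHardSphereTrajectory.finsum_ite_contact_one_eq` — in a regular geometry each collision is
  counted in its two orders, so the mark-`1` collision sum of `[0, τ]` is `2 · numCollisions 0 τ`;
* `lintegral_norm_sub_prod_gaussMeasure_le` — the Gaussian flux integral
  `∫ ‖w − v‖ dN(u,θ)(v) dN(u,θ)(w) ≤ 2 √(3θ)` (Cauchy–Schwarz on each factor);
* `XiN_pos_of_hsDiameter_lt_half`, `qN_le_of_hsDiameter_lt_half`,
  `posGibbs_pairEvent_le_of_hsDiameter_lt_half`, `posGibbs_pairEvent_le_five` — the crude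
  free-volume (insertion) bound `Ξ(m+1) ≥ (1 − λ) Ξ(m)`, `λ = v₁σ³ ≤ v₁/8 = π/6` (`v₁_eq`: the
  unit ball of `ℝ³` has volume `4π/3`), gives the Ruelle-type pair bound
  `posGibbs{xᵢ − xⱼ ∈ T} ≤ (1 − v₁σ³)⁻² vol T ≤ 5 vol T` for all `0 ≤ σ ≤ 1/2`, `N ≥ 1` (the parent
  file `HardSphereCanonicalPairBound` proves `≤ 4 vol T` under `SmallDensity`, Ruelle 1969 §4.2);
* `localGibbsLaw_lintegral_numCollisions_le` — the MEAN NUMBER OF COLLISIONS of `[0, τ]` under the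
  flow-invariant `G_N` is at most `C_p · 2τ(N+1)²ε² · ∫ ‖w − v‖`, i.e. with `(N+1)ε³ = σ³`,
  `τ = T ε/σ`: `≤ 4 √3 C_p · σ² √θ T · (N+1)` — `O(σ²√θ)` collisions per particle per unit of the
  kinetic time `T` (Spohn 1991 Part I §2.3, the equilibrium collision rate, as an upper bound);
* `localGibbsLaw_lintegral_busyCard_mul_succ_le` — by the double counting
  `(K+1) · #{busy} ≤ 2 · numCollisions` (`HardSphereFlow.succ_mul_busyCard_le_numCollisions` of
  `HardSphereBusyParticles`), the MEAN NUMBER OF BUSY PARTICLES (more than `K` collisions in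
  `(0, h]`) is at most `C_p · 4h(N+1)²ε² · ∫ ‖w − v‖ / (K+1)`: few busy particles in the mean once
  `K + 1 ≫` the mean number of collisions per particle of the window (first-moment form of the
  clamping step of coarse collision filtrations, Kipnis–Landim 1999 App. 1 §5–6).

The flow-invariance of `G_N` (`hstat`), the swept tubes (`htube`) and the minimal-image lift
inequality (`hlift`) stay hypotheses, as in `CollisionFluxUpperBound` (they are supplied by the
consumers on the problem side).

## References

* C. Cercignani, R. Illner, M. Pulvirenti, *The Mathematical Theory of Dilute Gases* (1994),
  App. 4.A.  [CIPDiluteGases1994]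
* H. Spohn, *Large Scale Dynamics of Interacting Particles* (1991), Part I §2.3.  [Spohn1991]
* D. Ruelle, *Statistical Mechanics: Rigorous Results* (1969), §4.2.  [Ruelle1969]
* C. Kipnis, C. Landim, *Scaling Limits of Interacting Particle Systems* (1999), App. 1 §5–6.
-/

noncomputable section

open MeasureTheory ProbabilityTheory Set Filter Topology
open scoped ENNReal InnerProductSpace BigOperators

namespace Literature.MathematicalPhysics.KineticTheory

open Literature.Analysis.FluidPDE Literature.Analysis.FunctionSpaces

/-! ## Counting collisions once: the mark `1` -/

/-- **Each collision in its two orders.** On a hard-sphere trajectory in a regular geometry the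
collision sum of the constant mark `1` over `[0, τ]` (inline ordered-pair form) is twice the number
of collisions `numCollisions G ε γ 0 τ` (dot-notation extension of
`Literature.Analysis.FluidPDE.IsHardSphereTrajectory`, declared with its absolute name). [folklore] -/
theorem _root_.Literature.Analysis.FluidPDE.IsHardSphereTrajectory.finsum_ite_contact_one_eq
    {d X : Type*} [Fintype d] [TopologicalSpace X] {G : Geometry d X} {ε : ℝ} {n : ℕ}
    {γ : ℝ → Config n d X} (h : IsHardSphereTrajectory G ε n γ) (hG : G.IsHardSphereRegular ε)
    (τ : ℝ) :
    (∑ᶠ s ∈ collisionTimes G ε γ ∩ Icc 0 τ, ∑ i, ∑ j,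
        (if i ≠ j ∧ ‖G.sepVec (γ s i).1 (γ s j).1‖ = ε then (1 : ℝ≥0∞) else 0)) =
      2 * (numCollisions G ε γ 0 τ : ℝ≥0∞) := by
  classical
  have hfin := h.locFinite 0 τ
  rw [finsum_mem_eq_finite_toFinset_sum _ hfin, h.numCollisions_eq 0 τ, Finset.card_eq_sum_ones,
    Nat.cast_sum, Finset.mul_sum]
  refine Finset.sum_congr rfl fun t ht => ?_
  have ht' : t ∈ collisionTimes G ε γ := ((Set.Finite.mem_toFinset hfin).1 ht).1
  rw [← sum_contactPairs_eq (h.mem t) (fun _ _ => (1 : ℝ≥0∞)), Finset.sum_const,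
    h.card_contactPairs_eq_two hG ht']
  simp

/-! ## The Gaussian flux integral -/

/-- `E ‖w‖ ≤ √3` under the standard Gaussian of `ℝ³` (Cauchy–Schwarz: `(E‖w‖)² ≤ E‖w‖² = 3`).
[folklore] -/
theorem integral_norm_stdGaussian_le_sqrt_three :
    ∫ w, ‖w‖ ∂stdGaussian V3 ≤ Real.sqrt 3 := by
  have hmem : MemLp (fun w : V3 => ‖w‖) 2 (stdGaussian V3) := (IsGaussian.memLp_id _ 2 (by simp)).norm
  have hvar := variance_nonneg (fun w : V3 => ‖w‖) (stdGaussian V3)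
  rw [variance_eq_sub hmem] at hvar
  have hsq : ∫ w, ((fun w : V3 => ‖w‖) ^ 2) w ∂stdGaussian V3 = 3 := by
    simp only [Pi.pow_apply]
    rw [integral_norm_sq_stdGaussian, Fintype.card_fin, Nat.cast_ofNat]
  rw [hsq] at hvar
  refine (Real.le_sqrt (integral_nonneg fun w => norm_nonneg w) (by norm_num)).2 ?_
  linarith

/-- `E ‖v − u‖ ≤ √(3θ)` under `N(u, θ)` on `ℝ³`. [folklore] -/
theorem integral_norm_sub_gaussMeasure_le (u : V3) {θ : ℝ} (hθ : 0 < θ) :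
    ∫ v, ‖v - u‖ ∂gaussMeasure u θ ≤ Real.sqrt (3 * θ) := by
  rw [integral_gaussMeasure u hθ]
  have h1 : ∀ w : V3, ‖u + Real.sqrt θ • w - u‖ = Real.sqrt θ * ‖w‖ := by
    intro w
    rw [add_sub_cancel_left, norm_smul, Real.norm_eq_abs, abs_of_nonneg (Real.sqrt_nonneg θ)]
  simp_rw [h1]
  rw [integral_const_mul, Real.sqrt_mul (by norm_num : (0 : ℝ) ≤ 3), mul_comm (Real.sqrt 3)]
  exact mul_le_mul_of_nonneg_left integral_norm_stdGaussian_le_sqrt_three (Real.sqrt_nonneg θ)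

/-- **The Gaussian flux integral**: `∫ ‖w − v‖ dN(u,θ)(v) dN(u,θ)(w) ≤ 2 √(3θ)` (`lintegral`
form). [folklore] -/
theorem lintegral_norm_sub_prod_gaussMeasure_le (u : V3) {θ : ℝ} (hθ : 0 < θ) :
    ∫⁻ p, ENNReal.ofReal ‖p.2 - p.1‖ ∂((gaussMeasure u θ).prod (gaussMeasure u θ)) ≤
      ENNReal.ofReal (2 * Real.sqrt (3 * θ)) := by
  set γ := gaussMeasure u θ with hγ
  set g : V3 → ℝ≥0∞ := fun v => ENNReal.ofReal ‖v - u‖ with hg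
  have hgm : Measurable g := by rw [hg]; fun_prop
  have hle : ∀ p : V3 × V3, ENNReal.ofReal ‖p.2 - p.1‖ ≤ g p.1 + g p.2 := by
    intro p
    rw [hg, ← ENNReal.ofReal_add (norm_nonneg _) (norm_nonneg _)]
    refine ENNReal.ofReal_le_ofReal ?_
    calc ‖p.2 - p.1‖ = ‖(p.2 - u) - (p.1 - u)‖ := by rw [sub_sub_sub_cancel_right]
      _ ≤ ‖p.2 - u‖ + ‖p.1 - u‖ := norm_sub_le _ _
      _ = ‖p.1 - u‖ + ‖p.2 - u‖ := add_comm _ _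
  have h1 : ∫⁻ p, g p.1 ∂(γ.prod γ) = ∫⁻ v, g v ∂γ := by
    calc ∫⁻ p, g p.1 ∂(γ.prod γ) = ∫⁻ v, ∫⁻ _w, g v ∂γ ∂γ :=
          lintegral_prod _ (hgm.comp measurable_fst).aemeasurable
      _ = ∫⁻ v, g v ∂γ := by simp only [lintegral_const, measure_univ, mul_one]
  have h2 : ∫⁻ p, g p.2 ∂(γ.prod γ) = ∫⁻ v, g v ∂γ := by
    calc ∫⁻ p, g p.2 ∂(γ.prod γ) = ∫⁻ _v, ∫⁻ w, g w ∂γ ∂γ :=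
          lintegral_prod _ (hgm.comp measurable_snd).aemeasurable
      _ = ∫⁻ v, g v ∂γ := by simp only [lintegral_const, measure_univ, mul_one]
  have hint : Integrable (fun v : V3 => ‖v - u‖) γ := (IsGaussian.integrable_id.sub (integrable_const u)).norm
  have h3 : ∫⁻ v, g v ∂γ ≤ ENNReal.ofReal (Real.sqrt (3 * θ)) := by
    rw [hg, ← ofReal_integral_eq_lintegral_ofReal hint (ae_of_all _ fun v => norm_nonneg _)]
    exact ENNReal.ofReal_le_ofReal (integral_norm_sub_gaussMeasure_le u hθ)
  calc ∫⁻ p, ENNReal.ofReal ‖p.2 - p.1‖ ∂(γ.prod γ) ≤ ∫⁻ p, (g p.1 + g p.2) ∂(γ.prod γ) :=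
        lintegral_mono hle
    _ = ∫⁻ v, g v ∂γ + ∫⁻ v, g v ∂γ := by
        rw [lintegral_add_left (show Measurable (fun p : V3 × V3 => g p.1) from
          hgm.comp measurable_fst), h1, h2]
    _ ≤ ENNReal.ofReal (Real.sqrt (3 * θ)) + ENNReal.ofReal (Real.sqrt (3 * θ)) := add_le_add h3 h3
    _ = ENNReal.ofReal (2 * Real.sqrt (3 * θ)) := by
        rw [← ENNReal.ofReal_add (Real.sqrt_nonneg _) (Real.sqrt_nonneg _), two_mul]

/-! ## The canonical pair bound at every reduced density `σ ≤ 1/2` -/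

/-- The unit ball of `ℝ³` has volume `v₁ = 4π/3`. [folklore] -/
theorem v₁_eq : v₁ = 4 / 3 * Real.pi := by
  rw [v₁, EuclideanSpace.volume_ball_fin_three, ENNReal.ofReal_one, one_pow, one_mul,
    ENNReal.toReal_ofReal (by positivity)]
  ring

/-- `v₁ σ³ ≤ 11/20` for `0 ≤ σ ≤ 1/2` (`v₁/8 = π/6 < 0.55`). [folklore] -/
theorem v₁_mul_cube_le {σ : ℝ} (hσ : 0 ≤ σ) (hσ2 : σ ≤ 1 / 2) : v₁ * σ ^ 3 ≤ 11 / 20 := by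
  have hπ := Real.pi_lt_d2
  have h3 : σ ^ 3 ≤ (1 / 2) ^ 3 := pow_le_pow_left₀ hσ hσ2 3
  rw [v₁_eq]
  nlinarith [Real.pi_pos]

/-- **Insertion bound below half the torus**: `Ξ_N(m) (1 − λ) ≤ Ξ_N(m+1)` for `m ≤ N`, assuming
only `ε_N = hsDiameter σ N < 1/2` (rather than `σ < 1/2`). [folklore] -/
theorem XiN_mul_le_succ_of_hsDiameter_lt_half {P : DensityProfile} {σ : ℝ} (hσ : 0 ≤ σ) {N : ℕ}
    (hε : hsDiameter σ N < 1 / 2) {m : ℕ} (hm : m ≤ N) :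
    XiN P σ N m * (1 - ovDensity P σ) ≤ XiN P σ N (m + 1) := by
  have h := Xi_succ_ge (P := P) (n := N + 1) (hsDiameter_nonneg' hσ N) hε (m := m) (by omega)
  refine le_trans (mul_le_mul_of_nonneg_left ?_ (Xi_nonneg _)) h
  linarith [mul_pOv_le_ovDensity (P := P) hσ (N := N) (m := m) (by omega)]

/-- Positivity of the partition functions below half the torus: `0 < Ξ_N(m)`, `m ≤ N + 1`, for
`ε_N < 1/2` and `λ < 1`. [folklore] -/
theorem XiN_pos_of_hsDiameter_lt_half {P : DensityProfile} {σ : ℝ} (hσ : 0 ≤ σ) {N : ℕ}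
    (hε : hsDiameter σ N < 1 / 2) (hlam : ovDensity P σ < 1) {m : ℕ} (hm : m ≤ N + 1) :
    0 < XiN P σ N m := by
  induction m with
  | zero => rw [XiN, Xi_zero]; exact one_pos
  | succ m ih =>
      have h := XiN_mul_le_succ_of_hsDiameter_lt_half (P := P) hσ hε (m := m) (by omega)
      exact lt_of_lt_of_le (mul_pos (ih (by omega)) (by linarith)) h

/-- The insertion ratio bound below half the torus: `q_N(m) ≤ (1 − λ)⁻¹` for `m ≤ N`. [folklore] -/
theorem qN_le_of_hsDiameter_lt_half {P : DensityProfile} {σ : ℝ} (hσ : 0 ≤ σ) {N : ℕ}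
    (hε : hsDiameter σ N < 1 / 2) (hlam : ovDensity P σ < 1) {m : ℕ} (hm : m ≤ N) :
    qN P σ N m ≤ (1 - ovDensity P σ)⁻¹ := by
  rw [qN, div_le_iff₀ (XiN_pos_of_hsDiameter_lt_half hσ hε hlam (by omega)), ← div_eq_inv_mul,
    le_div_iff₀ (by linarith)]
  exact XiN_mul_le_succ_of_hsDiameter_lt_half hσ hε hm

/-- **Free-volume pair bound for the canonical hard-sphere gas at every density with `v₁σ³ < 1`.**
For `σ ≥ 0`, `N ≥ 1`, `ε_N = hsDiameter σ N < 1/2`, `λ = v₁σ³ < 1`, `i ≠ j` and measurable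
`T ⊆ 𝕋³`: `posGibbsMeasure 1 ε_N (N+1) {xᵢ − xⱼ ∈ T} ≤ (1 − λ)⁻² · vol T` (drop the hard-core
constraints involving `i, j`, `posGibbs_pairEvent_le_ratio`, and bound the two insertion ratios by
`(1 − λ)⁻¹`; Ruelle 1969 §4.2). [folklore] -/
theorem posGibbs_pairEvent_le_of_hsDiameter_lt_half {σ : ℝ} (hσ : 0 ≤ σ) {N : ℕ} (hN : 1 ≤ N)
    (hε : hsDiameter σ N < 1 / 2) (hlam : v₁ * σ ^ 3 < 1) {i j : Fin (N + 1)} (hij : i ≠ j)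
    {T : Set T3} (hT : MeasurableSet T) :
    posGibbsMeasure (fun _ => (1 : ℝ)) (hsDiameter σ N) (N + 1) {x | x i - x j ∈ T} ≤
      ENNReal.ofReal ((1 - v₁ * σ ^ 3)⁻¹ ^ 2) * volume T := by
  have hlam' : ovDensity uniformProfile σ < 1 := by rwa [ovDensity_uniformProfile]
  have hpos : ∀ m ≤ N + 1, 0 < XiN uniformProfile σ N m := fun m hm =>
    XiN_pos_of_hsDiameter_lt_half hσ hε hlam' hm
  refine (posGibbs_pairEvent_le_ratio (hsDiameter σ N) hij hT).trans ?_
  rw [hcProb_sdiff_pair_div_eq σ hN hij hpos]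
  refine mul_le_mul' (ENNReal.ofReal_le_ofReal ?_) le_rfl
  have hq1 : qN uniformProfile σ N (N - 1) ≤ (1 - v₁ * σ ^ 3)⁻¹ := by
    rw [← ovDensity_uniformProfile]; exact qN_le_of_hsDiameter_lt_half hσ hε hlam' (by omega)
  have hq2 : qN uniformProfile σ N N ≤ (1 - v₁ * σ ^ 3)⁻¹ := by
    rw [← ovDensity_uniformProfile]; exact qN_le_of_hsDiameter_lt_half hσ hε hlam' le_rfl
  have hq1' : 0 ≤ qN uniformProfile σ N (N - 1) :=
    div_nonneg (Xi_nonneg _) (Xi_nonneg _)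
  have hq2' : 0 ≤ qN uniformProfile σ N N := div_nonneg (Xi_nonneg _) (Xi_nonneg _)
  calc qN uniformProfile σ N (N - 1) * qN uniformProfile σ N N
      ≤ (1 - v₁ * σ ^ 3)⁻¹ * (1 - v₁ * σ ^ 3)⁻¹ :=
        mul_le_mul hq1 hq2 hq2' (hq1'.trans hq1)
    _ = (1 - v₁ * σ ^ 3)⁻¹ ^ 2 := (sq _).symm

/-- `ε_N < 1/2` for `σ ≤ 1/2` and `N ≥ 1`. [folklore] -/
theorem hsDiameter_lt_half_of_one_le {σ : ℝ} (hσ2 : σ ≤ 1 / 2) {N : ℕ} (hN : 1 ≤ N) :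
    hsDiameter σ N < 1 / 2 := by
  unfold hsDiameter
  have hlt : ((N + 1 : ℕ) : ℝ) ^ (-(1 / 3 : ℝ)) < 1 := by
    refine Real.rpow_lt_one_of_one_lt_of_neg ?_ (by norm_num)
    have : (2 : ℝ) ≤ ((N + 1 : ℕ) : ℝ) := by exact_mod_cast Nat.succ_le_succ hN
    linarith
  have h0 : 0 < ((N + 1 : ℕ) : ℝ) ^ (-(1 / 3 : ℝ)) := Real.rpow_pos_of_pos (by positivity) _
  nlinarith

/-- **The canonical pair law is at most `5 ×` Haar measure at every reduced density `σ ≤ 1/2`**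
(`N ≥ 1`): `(1 − v₁σ³)⁻² ≤ (1 − 11/20)⁻² < 5`. [folklore] -/
theorem posGibbs_pairEvent_le_five {σ : ℝ} (hσ : 0 ≤ σ) (hσ2 : σ ≤ 1 / 2) {N : ℕ} (hN : 1 ≤ N)
    {i j : Fin (N + 1)} (hij : i ≠ j) {T : Set T3} (hT : MeasurableSet T) :
    posGibbsMeasure (fun _ => (1 : ℝ)) (hsDiameter σ N) (N + 1) {x | x i - x j ∈ T} ≤ 5 * volume T := by
  have hl := v₁_mul_cube_le hσ hσ2
  have hlam : v₁ * σ ^ 3 < 1 := by linarith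
  refine (posGibbs_pairEvent_le_of_hsDiameter_lt_half hσ hN (hsDiameter_lt_half_of_one_le hσ2 hN)
    hlam hij hT).trans (mul_le_mul' ?_ le_rfl)
  rw [← ENNReal.ofReal_ofNat 5]
  refine ENNReal.ofReal_le_ofReal ?_
  have h0 : 0 < 1 - v₁ * σ ^ 3 := by linarith
  have h1 : (1 - v₁ * σ ^ 3)⁻¹ ≤ 20 / 9 := by
    rw [inv_le_comm₀ h0 (by norm_num)]
    linarith
  have h2 : 0 ≤ (1 - v₁ * σ ^ 3)⁻¹ := inv_nonneg.2 h0.le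
  nlinarith

/-! ## The mean number of collisions and of busy particles under `G_N` -/

section MeanCounts

variable {σ : ℝ} {a θ : ℝ} {N : ℕ}
  (Φ : HardSphereFlow (Torus.geometry (Fin 3)) (hsDiameter σ N) (N + 1)) {Cp : ℝ≥0∞}

/-- **The mean number of collisions of a window under `G_N`.** For `σ ≤ 1/2`, `a, θ > 0`, `u`,
`ε_N < 1/2` (regular torus geometry), a flow `Φ` preserving `G_N` (`hstat`), a pair law at most
`C_p ×` Haar (`hpair`), swept tubes (`htube`) and the lift inequality (`hlift`): the mean number of
collisions in `[0, τ]` is at most `C_p · 2 τ (N+1)² ε² · ∫ ‖p.2 − p.1‖ d(N(u,θ) ⊗ N(u,θ))(p)`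
(`numCollisions` is junk off the good set, which is `G_N`-null). [folklore] -/
theorem localGibbsLaw_lintegral_numCollisions_le (hσ2 : σ ≤ 1 / 2) (ha : 0 < a) (hθ : 0 < θ)
    (u : V3) (hε : hsDiameter σ N < 1 / 2)
    (hstat : ∀ t : ℝ, MeasurePreserving (Φ.flow t) (localGibbsLaw σ (fun _ => a) (fun _ => u) (fun _ => θ) N Φ)
      (localGibbsLaw σ (fun _ => a) (fun _ => u) (fun _ => θ) N Φ))
    (hpair : ∀ i j : Fin (N + 1), i ≠ j → ∀ T : Set T3, MeasurableSet T →
      posGibbsMeasure (fun _ : T3 => (1 : ℝ)) (hsDiameter σ N) (N + 1) {x | x i - x j ∈ T} ≤ Cp * volume T)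
    (htube : ∀ h : ℝ, 0 ≤ h → ∃ S : V3 → Set V3, MeasurableSet {q : V3 × V3 | q.1 ∈ S q.2} ∧
      (∀ u, volume (S u) ≤ ENNReal.ofReal (4 * hsDiameter σ N ^ 2 * h * ‖u‖)) ∧
      ∀ (u r : V3) (s : ℝ), hsDiameter σ N ≤ ‖r‖ → s ∈ Icc 0 h → ‖r + s • u‖ = hsDiameter σ N → r ∈ S u)
    (hlift : ∀ B : Set V3, MeasurableSet B →
      volume {x : T3 | ∃ k : Fin 3 → ℤ, Torus.reprSym x + Torus.latticeVec k ∈ B} ≤ volume B)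
    {τ : ℝ} (hτ : 0 < τ) :
    ∫⁻ z, (numCollisions (Torus.geometry (Fin 3)) (hsDiameter σ N) (fun t => Φ.flow t z) 0 τ : ℝ≥0∞)
        ∂(localGibbsLaw σ (fun _ => a) (fun _ => u) (fun _ => θ) N Φ) ≤
      Cp * ENNReal.ofReal (2 * τ * ((N + 1 : ℕ) : ℝ) ^ 2 * hsDiameter σ N ^ 2) *
        ∫⁻ p, ENNReal.ofReal ‖p.2 - p.1‖ ∂((gaussMeasure u θ).prod (gaussMeasure u θ)) := by
  have hG := Torus.isHardSphereRegular_geometry (d := Fin 3) (by simpa only [one_div] using hε)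
  -- `2 · numCollisions` is dominated by (equal to) the mark-`1` collision sum on the good set
  have h1 := localGibbsLaw_lintegral_le_of_le_collisionMarkSum hσ2 ha hθ u Φ hstat hpair htube hlift hτ
    (b := fun _ => (1 : ℝ≥0∞)) measurable_const
    (fun z => 2 * (numCollisions (Torus.geometry (Fin 3)) (hsDiameter σ N) (fun t => Φ.flow t z) 0 τ : ℝ≥0∞))
    (fun z hz => ((Φ.isTrajectory z hz).finsum_ite_contact_one_eq hG τ).symm.le)
  simp only [mul_one] at h1
  rw [lintegral_const_mul' _ _ ENNReal.ofNat_ne_top] at h1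
  have h4 : Cp * ENNReal.ofReal (4 * τ * ((N + 1 : ℕ) : ℝ) ^ 2 * hsDiameter σ N ^ 2) *
      ∫⁻ p, ENNReal.ofReal ‖p.2 - p.1‖ ∂((gaussMeasure u θ).prod (gaussMeasure u θ)) =
      2 * (Cp * ENNReal.ofReal (2 * τ * ((N + 1 : ℕ) : ℝ) ^ 2 * hsDiameter σ N ^ 2) *
        ∫⁻ p, ENNReal.ofReal ‖p.2 - p.1‖ ∂((gaussMeasure u θ).prod (gaussMeasure u θ))) := by
    have h5 : ENNReal.ofReal (4 * τ * ((N + 1 : ℕ) : ℝ) ^ 2 * hsDiameter σ N ^ 2) =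
        2 * ENNReal.ofReal (2 * τ * ((N + 1 : ℕ) : ℝ) ^ 2 * hsDiameter σ N ^ 2) := by
      rw [← ENNReal.ofReal_ofNat 2, ← ENNReal.ofReal_mul (by positivity)]
      congr 1
      ring
    rw [h5]
    ring
  rw [h4] at h1
  exact (ENNReal.mul_le_mul_iff_right (by norm_num) ENNReal.ofNat_ne_top).1 h1

/-- **The mean number of busy particles of a window under `G_N`.** Same setting, window `(0, h]`
(`h > 0`) and threshold `K`: the mean over `G_N` of the number of particles with more than `K`
collisions in `(0, h]`, times `K + 1`, is at most
`C_p · 4 h (N+1)² ε² · ∫ ‖p.2 − p.1‖ d(N(u,θ) ⊗ N(u,θ))(p)` — twice the mean-number-of-collisions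
bound (each collision makes two particles busier). [folklore] -/
theorem localGibbsLaw_lintegral_busyCard_mul_succ_le (hσ2 : σ ≤ 1 / 2) (ha : 0 < a) (hθ : 0 < θ)
    (u : V3) (hε : hsDiameter σ N < 1 / 2)
    (hstat : ∀ t : ℝ, MeasurePreserving (Φ.flow t) (localGibbsLaw σ (fun _ => a) (fun _ => u) (fun _ => θ) N Φ)
      (localGibbsLaw σ (fun _ => a) (fun _ => u) (fun _ => θ) N Φ))
    (hpair : ∀ i j : Fin (N + 1), i ≠ j → ∀ T : Set T3, MeasurableSet T →
      posGibbsMeasure (fun _ : T3 => (1 : ℝ)) (hsDiameter σ N) (N + 1) {x | x i - x j ∈ T} ≤ Cp * volume T)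
    (htube : ∀ h : ℝ, 0 ≤ h → ∃ S : V3 → Set V3, MeasurableSet {q : V3 × V3 | q.1 ∈ S q.2} ∧
      (∀ u, volume (S u) ≤ ENNReal.ofReal (4 * hsDiameter σ N ^ 2 * h * ‖u‖)) ∧
      ∀ (u r : V3) (s : ℝ), hsDiameter σ N ≤ ‖r‖ → s ∈ Icc 0 h → ‖r + s • u‖ = hsDiameter σ N → r ∈ S u)
    (hlift : ∀ B : Set V3, MeasurableSet B →
      volume {x : T3 | ∃ k : Fin 3 → ℤ, Torus.reprSym x + Torus.latticeVec k ∈ B} ≤ volume B)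
    {h : ℝ} (hh : 0 < h) (K : ℕ) :
    (∫⁻ z, ((Finset.univ.filter fun i => K < (collisionTimesOf (Torus.geometry (Fin 3)) (hsDiameter σ N)
        (fun s => Φ.flow s z) i ∩ Ioc 0 h).ncard).card : ℝ≥0∞)
        ∂(localGibbsLaw σ (fun _ => a) (fun _ => u) (fun _ => θ) N Φ)) * ((K : ℝ≥0∞) + 1) ≤
      Cp * ENNReal.ofReal (4 * h * ((N + 1 : ℕ) : ℝ) ^ 2 * hsDiameter σ N ^ 2) *
        ∫⁻ p, ENNReal.ofReal ‖p.2 - p.1‖ ∂((gaussMeasure u θ).prod (gaussMeasure u θ)) := by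
  have hG := Torus.isHardSphereRegular_geometry (d := Fin 3) (by simpa only [one_div] using hε)
  have hK : ((K : ℝ≥0∞) + 1) ≠ ⊤ := by simp
  rw [← lintegral_mul_const' _ _ hK]
  have h1 := localGibbsLaw_lintegral_le_of_le_collisionMarkSum hσ2 ha hθ u Φ hstat hpair htube hlift hh
    (b := fun _ => (1 : ℝ≥0∞)) measurable_const
    (fun z => ((Finset.univ.filter fun i => K < (collisionTimesOf (Torus.geometry (Fin 3)) (hsDiameter σ N)
        (fun s => Φ.flow s z) i ∩ Ioc 0 h).ncard).card : ℝ≥0∞) * ((K : ℝ≥0∞) + 1))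
    (fun z hz => (Φ.busyCard_mul_succ_le_ennreal hz K h).trans
      ((Φ.isTrajectory z hz).finsum_ite_contact_one_eq hG h).symm.le)
  simpa only [mul_one] using h1

end MeanCounts

end Literature.MathematicalPhysics.KineticTheory

end
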